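import Literature.NumberTheory.Automorphic.CDTTheorem722ThreeFactsProofs
import Literature.NumberTheory.EllipticCurves.IsogenyFrobeniusTraceHoldsProofs
import Literature.NumberTheory.EllipticCurves.CuspFormLFunctionLevelConductorOfCarayolProofs
import Literature.NumberTheory.EllipticCurves.OggFormulaPotGoodOrdinaryTwoProofs
import Literature.NumberTheory.EllipticCurves.HasseWeilAbelianConductorSwanIndependenceTwoProofs
import HarnessLib

/-!
# Stub ideas `stub_threeImpTwo` (S9, BCDT (3) ⇒ (2)) — ideator k1, gen 19: elab sanity of the helper statements

Companion of `STUB-IDEAS-stub_threeImpTwo-1.md` (gen 19).  Plan of record = gen 16–18's Plan A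
(`STUB_IDEAS_stub_threeImpTwo_1g16.lean`, all helpers PROVED); the only gen-19 delta typed here is
**H2♯**: the Saito-at-2 leaf in the tree's FINEST open form (additive, `|j|₂ < 1` AND `j ≠ 0` —
the `j = 0` curves were settled by `OggFormulaJZeroTwoProofs`), one binder sharper than gen 16's
`SaitoTwoSupersingularResidual`.  Every proof is a by-name one-liner (no transcription).
-/

set_option linter.dupNamespace false

noncomputable section

open scoped NumberField MatrixGroups ModularForm
open NumberField IsDedekindDomain CongruenceSubgroup
open Literature.NumberTheory.EllipticCurves
open Literature.NumberTheory.EllipticCurves.ModularForms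
open Literature.NumberTheory.Automorphic
open Literature.NumberTheory.Automorphic.BCDT
open Literature.NumberTheory.GaloisRepresentations
open WeierstrassCurve

namespace Summit.ABC.ABC.Cruxes.FreyModularity.Sketch.StubIdeasThreeImpTwo1G19b

/-- The registered stub's type, character for character (`Lines/Sketch.lean` :186). -/
def SigS9 : Prop :=
  ∀ (W : WeierstrassCurve ℚ) [W.IsElliptic] [NeZero (W.conductorNorm ℤ)] (ℓ : ℕ) [Fact ℓ.Prime],
    W.IsModularGaloisRepTate ℓ → BCDT.IsModular W

example : SigS9 = (∀ (W : WeierstrassCurve ℚ) [W.IsElliptic] [NeZero (W.conductorNorm ℤ)] (ℓ : ℕ)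
    [Fact ℓ.Prime], W.IsModularGaloisRepTate ℓ → BCDT.IsModular W) := rfl

/-- `hC` of the skeleton closer `stub_threeImpTwo_of_two_facts` (:584), verbatim. -/
def CarayolLevel : Prop :=
  ∀ (N : ℕ) [NeZero N], IsNewformOf.level_eq_conductorNorm (N := N)

/-- Saito's `p = 2` half of Ogg's formula, every curve over `ℚ`, every `ℓ` (binder `hS` of the tree's
`IsNewformOf.forall_level_eq_conductorNorm_of_carayol1986_of_saito`). -/
def SaitoTwoAll : Prop :=
  ∀ (V : WeierstrassCurve ℚ) (ℓ : ℕ) [Fact ℓ.Prime],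
    V.swanConductorAt_rationalTate_eq_wildConductorExponent_of_ringChar_eq_two ℓ

attribute [local instance] AddSubgroup.torsionBy.zmodModule in
/-- **L2b♯ — the tree's FINEST open residual of Saito 1988 over `ℚ`** (hypothesis `H` of
`swanConductorAt_rationalTate_eq_wildConductorExponent_of_ringChar_eq_two_of_valuation_j_lt_one_of_j_ne_zero`,
`OggFormulaJZeroTwoProofs` :223, quantified over the curve): additive, potentially good reduction at `2`
with `ord₂(j) > 0` and `j ≠ 0`, read on `E[3]` at one prime above `2`. -/
def SaitoTwoResidualJNeZero : Prop :=
  ∀ (V : WeierstrassCurve ℚ) [V.IsElliptic],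
    V.HasAdditiveReductionAt ((Rat.HeightOneSpectrum.primesEquiv (R := 𝓞 ℚ)).symm ⟨2, Nat.prime_two⟩) →
    ((Rat.HeightOneSpectrum.primesEquiv (R := 𝓞 ℚ)).symm ⟨2, Nat.prime_two⟩).valuation ℚ V.j < 1 →
    V.j ≠ 0 →
    ∃ 𝔓 ∈ ((Rat.HeightOneSpectrum.primesEquiv (R := 𝓞 ℚ)).symm ⟨2, Nat.prime_two⟩).primesAbove,
      (V.torsionGaloisRep 3).swanConductorAt (𝓞 ℚ) 𝔓 =
        (V.wildConductorExponent
          ((Rat.HeightOneSpectrum.primesEquiv (R := 𝓞 ℚ)).symm ⟨2, Nat.prime_two⟩) : ℝ)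

/-- **H2♯ (XS) — STATEMENT ONLY in this variant**: its one-line proof
`fun V ℓ _ ↦ V.…_of_valuation_j_lt_one_of_j_ne_zero ℓ (fun hadd hlt hj ↦ H V hadd hlt hj)` needs
`Literature.NumberTheory.EllipticCurves.OggFormulaJZeroTwoProofs`, which is `stale:unbuilt` on the check
farm (2026-09-01T02:25Z); see `Sketch.lean` for the by-name version. -/
def H2SharpStatement : Prop := SaitoTwoResidualJNeZero → SaitoTwoAll

attribute [local instance] AddSubgroup.torsionBy.zmodModule in
/-- Gen-16's coarser residual (no `j ≠ 0` binder), whose reduction IS built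
(`…_of_valuation_j_lt_one`, `OggFormulaPotGoodOrdinaryTwoProofs`). -/
def SaitoTwoSupersingularResidual : Prop :=
  ∀ (V : WeierstrassCurve ℚ) [V.IsElliptic],
    V.HasAdditiveReductionAt ((Rat.HeightOneSpectrum.primesEquiv (R := 𝓞 ℚ)).symm ⟨2, Nat.prime_two⟩) →
    ((Rat.HeightOneSpectrum.primesEquiv (R := 𝓞 ℚ)).symm ⟨2, Nat.prime_two⟩).valuation ℚ V.j < 1 →
    ∃ 𝔓 ∈ ((Rat.HeightOneSpectrum.primesEquiv (R := 𝓞 ℚ)).symm ⟨2, Nat.prime_two⟩).primesAbove,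
      (V.torsionGaloisRep 3).swanConductorAt (𝓞 ℚ) 𝔓 =
        (V.wildConductorExponent
          ((Rat.HeightOneSpectrum.primesEquiv (R := 𝓞 ℚ)).symm ⟨2, Nat.prime_two⟩) : ℝ)

/-- The sharper residual is implied by the coarser one (trivially: drop `j ≠ 0`). -/
theorem saitoTwoResidualJNeZero_of_residual (H : SaitoTwoSupersingularResidual) :
    SaitoTwoResidualJNeZero :=
  fun V _ hadd hlt _ ↦ H V hadd hlt

attribute [local instance] AddSubgroup.torsionBy.zmodModule in
/-- **H2 (gen 16, XS, by name; built).** -/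
theorem saitoTwoAll_of_residual (H : SaitoTwoSupersingularResidual) : SaitoTwoAll :=
  fun V ℓ _ ↦
    V.swanConductorAt_rationalTate_eq_wildConductorExponent_of_ringChar_eq_two_of_valuation_j_lt_one ℓ (H V)

/-- **H3 (XS, by name).** `hC` from Carayol (A) + Saito-at-2. -/
theorem carayolLevel_of_carayol1986_of_saito (hCA : Carayol1986_artinConductorExponent)
    (hS : SaitoTwoAll) : CarayolLevel :=
  IsNewformOf.forall_level_eq_conductorNorm_of_carayol1986_of_saito hCA hS

/-- **H4 (XS, by name).** The verbatim stub from {ES, Carayol (A), Saito-at-2}; Faltings' isogeny theorem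
is the tree's `isIsogenous_iff_frobeniusTrace_eq_holds`. -/
theorem sigS9_of_ES_of_carayol1986_of_saito (hES : eichlerShimuraConstruction)
    (hCA : Carayol1986_artinConductorExponent) (hS : SaitoTwoAll) : SigS9 :=
  fun W _ _ ℓ _ h ↦
    isModular_of_isModularGaloisRepTate_of_three_facts hES isIsogenous_iff_frobeniusTrace_eq_holds
      (carayolLevel_of_carayol1986_of_saito hCA hS) W ℓ h

/-- **Plan A closer (PROVED, built imports): the stub, typed literally, from ES + Carayol (A) + gen-16's
Saito residual.** -/
theorem stub_threeImpTwo_of_ES_of_carayol1986_of_saitoResidual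
    (hES : eichlerShimuraConstruction) (hCA : Carayol1986_artinConductorExponent)
    (H : SaitoTwoSupersingularResidual) :
    ∀ (W : WeierstrassCurve ℚ) [W.IsElliptic] [NeZero (W.conductorNorm ℤ)] (ℓ : ℕ) [Fact ℓ.Prime],
      W.IsModularGaloisRepTate ℓ → BCDT.IsModular W :=
  sigS9_of_ES_of_carayol1986_of_saito hES hCA (saitoTwoAll_of_residual H)

/-- **Plan A♯ closer modulo H2♯** (H2♯ becomes a by-name one-liner once `OggFormulaJZeroTwoProofs` is built). -/
theorem stub_threeImpTwo_of_ES_of_carayol1986_of_saitoResidualJNeZero (h2 : H2SharpStatement)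
    (hES : eichlerShimuraConstruction) (hCA : Carayol1986_artinConductorExponent)
    (H : SaitoTwoResidualJNeZero) :
    ∀ (W : WeierstrassCurve ℚ) [W.IsElliptic] [NeZero (W.conductorNorm ℤ)] (ℓ : ℕ) [Fact ℓ.Prime],
      W.IsModularGaloisRepTate ℓ → BCDT.IsModular W :=
  sigS9_of_ES_of_carayol1986_of_saito hES hCA (h2 H)

end Summit.ABC.ABC.Cruxes.FreyModularity.Sketch.StubIdeasThreeImpTwo1G19b

end
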